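import Literature.NumberTheory.Sieve.LargestPrimeFactorCubicGenerators
import Literature.NumberTheory.Sieve.HeathBrownCubicWindow
import Literature.NumberTheory.Sieve.SieveFrameworkFundamentalLemma
import HarnessLib

/-!
# Heath-Brown 2001, §2: the sieve set-up — generators, the weighted count `S = X S₀ + S₁`, and
# the weights `W(n)` with `S ≤ ∑ W(n)`, `W(n) ≤ min(Ω, 321) 2^Ω`

Eighth proved layer of this seat under the named fact `HeathBrown2001_largestPrimeFactor_cubic`
(`LargestPrimeFactorCubic.lean`; D. R. Heath-Brown, *The largest prime factor of `X³ + 2`*, Proc.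
London Math. Soc. (3) 82 (2001) 554–596).  §2 (pp. 559–561) sets up the count

  `S = ∑_{K ∈ 𝒦} ∑_{L ∈ 𝓛(K)} (∑_{d ∣ (Q, N(L))} λ_d) #𝒜_{KL}`,  `𝒜_I = {X < n ≤ 2X : I ∣ n + ∛2}`,

where `K` runs over first-degree prime ideals with `X^{3δ} < N(K) ≤ X^{4δ}` (2.4), `KL = (α)` runs
over principal ideals generated by `α = a + b∛2 + c∛4` subject to (2.10)–(2.17), `λ_d` are "the
Rosser weights for the lower bound sieve of dimension 1 and sieving limit `X^{3δ}`" supported on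
`d ≤ X^{3δ}`, `d ∣ Q = ∏_{p < X^δ} p`, and `δ = 1/321`; then (p. 561) `S ≤ ∑_n W(n)` with
`W(n) = #{(K, L) : (N(L), Q) = 1, KL ∣ n + ∛2}` by (2.7), every `n` with `W(n) > 0` is in `𝒜^{(1)}`,
`W(n)` is bounded through the number of prime ideal factors of `n + ∛2` of norm `≥ X^δ`, and
`S = X S₀ + S₁` by `#𝒜_I = X ρ(I)/N(I) + R_I`.

This file DEFINES these objects for the tree's `K = ℚ(∛2)` and PROVES the four structural facts,
in the rational currency of `…HBWeights` (`HeathBrown2001_largestPrimeFactor_cubic_of_divisorWeights`):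

* objects: `hbδ = 1/321`; `Npar X = X^{(1+2δ)/3}` (`N` of (2.6)); the generator boxes `genBox`
  at the scales `tscale X i = N (19/20)^i`, `i ∈ scales X` (those with `0.93 t_i³ ≥ X^{1+3δ/2}`):
  `a ∈ (t, 1.01t]`, `b, c ∈ (t/10, 0.11t]` — a union of cubes inside Heath-Brown's region `𝓡`
  ((2.12)–(2.13); see "Deviations"); the arithmetic conditions `IsBasePair` on `(a, b)`
  (`q = a³ − 2b³` squarefree, `(q, 6) = 1` — (2.15)–(2.16), which give (2.10) and `(a, b) = 1` — and
  (2.17): `q₁q₂ ∣ q` for primes `q₁ ∈ (N^{5/7}, N^{5/7+δ}]`, `q₂ ∈ (N^{6/7}, N^{6/7+δ}]`) and on `c`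
  (`cSet`: `(b² − ac, q) = (a² + bc, q) = 1`, (2.11)); the generator set `gens X P` for any choice
  `P i ⊆ basePairs X i` of admissible pairs; the `𝒦`-primes `kPrimes X` (`X^{3δ} < p ≤ X^{4δ}`); the
  Rosser lower-bound weights `lam X d = μ(d) χ⁻(d)` of level `X^{3δ}` and `β = 2` (the tree's
  `BetaSieve.ind 0 2`), the weight `wt X v p = ∑_{d ∣ (N(α)/p, P(X^δ))} λ_d`, the counts
  `Acount X v = #𝒜_{(α)}`, and `S`, `S₀`, `S₁`, `W`;
* `S_eq` — `S = X S₀ + S₁`;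
* `S_le_sum_W` — `S ≤ ∑_{X < n ≤ 2X} W(n)` (the lower sieve inequality (2.7),
  `BetaSieve.lower_sieve`);
* `W_pos_imp` — `W(n) > 0 ⇒ n³ + 2` has the divisor `d = N(α)`, `X^{1+δ} < d`, all prime factors
  `≤ 3X` (p. 560);
* `W_le` — `W(n) ≤ min(Ω(n), 321) · 2^{Ω(n)}`, `Ω(n)` the number of prime factors `≥ ⌈X^δ⌉` of
  `n³ + 2` with multiplicity (p. 561 with Irving's bookkeeping, Acta Arith. 171 (2015) §2): the map
  `(α, K) ↦ (N(L), N(K))` is injective (`gens_injective`: the ideals `(α)` are pairwise distinct —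
  norms separate the scales, and within a scale two generators of one ideal differ by a unit `u`
  with `σ₁(u) ∈ (0.95, 1.05)`, impossible unless `u = 1` since `E ≥ 19/5` (`unitE_ge`); then
  Lemma 1, `eq_of_natCast_add_θint_mem_of_absNorm_eq`), with image in
  `{X^δ-rough divisors of n³+2} × {primes p ∣ n³+2, p > X^{3δ}}`.

Deviations from print (construction, not statement — the four facts above are what §2 uses):
(1) the region: Heath-Brown's `𝓡` is `M³ < N(x) ≤ N³`, `1 ≤ x₁ + x₂∛2 + x₃∛4 < ε₀ N(x)^{1/3}`,
`x₁³ − 2x₂³ ≥ M³`; we use the explicit sub-family of cubes above (each inside `𝓡`: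
`0.93t³ < N(α) < 0.98t³`, `σ₁(α)/N(α)^{1/3} ∈ (1.28, 1.37) ⊂ [1, ε₀)`, `q > 0.99t³ > M³`), which
only lowers `S₀` by a constant factor (immaterial by `…HBWeights`, which needs `∑ W ≥ 10⁻⁹⁰X`
where Heath-Brown has `9.2·10⁻⁸X`) and keeps every hypothesis of Lemmas 4–5 (`a, b, c ≪ N`,
`N(α), q ≫ M³`, distinct ideals); (2) the admissible pairs `P i` are a parameter (any subset of
the pairs satisfying (2.15)–(2.17)), fixed only in the final assembly; (3) `Q = P(X^δ)` is the
product of ALL primes `< X^δ` (Heath-Brown restricts to split primes; the extra primes never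
divide `N(L)`, so `W` and `S` are unchanged, cf. §4 p. 569).

## References

* D. R. Heath-Brown, *The largest prime factor of `X³ + 2`*, Proc. London Math. Soc. (3) 82 (2001)
  554–596, §2 pp. 559–562 ((2.3)–(2.17), Lemma 3). [`HeathBrown2001LargestPrimeFactorCubic`]
* A. J. Irving, *The largest prime factor of `X³ + 2`*, Acta Arith. 171 (2015), §2 (the bound
  `W ≤ min(Ω_δ, [1/δ]) 2^{Ω_δ}`). [`Irving2014LargestPrimeFactorCubic`]
* H. Iwaniec, *Rosser's sieve*, Acta Arith. 36 (1980) 171–202 (the weights `λ_d`, cited as [7]).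
  [`IwaniecActaArith1980`]
-/

noncomputable section

open NumberField Finset Real

namespace Literature.NumberTheory.Sieve.LargestPrimeFactorCubic

open LFunctions.CubeRootTwoField CubicSieve BetaSieve

/-! ### Parameters -/

/-- Heath-Brown's `δ = 1/321` (Lemma 5, p. 563). [cite: HeathBrown2001LargestPrimeFactorCubic, Lemma 5] -/
def hbδ : ℝ := 1 / 321

/-- Auxiliary fact `hbδ_pos` for this file's estimates. [folklore] -/
theorem hbδ_pos : 0 < hbδ := by unfold hbδ; norm_num

/-- Auxiliary fact `hbδ_lt` for this file's estimates. [folklore] -/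
theorem hbδ_lt : hbδ < 1 / 100 := by unfold hbδ; norm_num

/-- `N = X^{(1+2δ)/3}` of (2.6): `N³ = X^{1+2δ}` is the upper end of the range (2.3) for `N(KL)`.
[cite: HeathBrown2001LargestPrimeFactorCubic, (2.6)] -/
def Npar (X : ℕ) : ℝ := (X : ℝ) ^ ((1 + 2 * hbδ) / 3)

/-- Auxiliary fact `Npar_nonneg` for this file's estimates. [folklore] -/
theorem Npar_nonneg (X : ℕ) : 0 ≤ Npar X := by unfold Npar; positivity

/-- Auxiliary fact `Npar_pow_three` for this file's estimates. [folklore] -/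
theorem Npar_pow_three (X : ℕ) : Npar X ^ 3 = (X : ℝ) ^ (1 + 2 * hbδ) := by
  unfold Npar
  rw [← Real.rpow_natCast, ← Real.rpow_mul (Nat.cast_nonneg X)]
  norm_num

/-- The scales `t_i = N (19/20)^i`, `i = 0, 1, 2, …` at which the generator cubes sit.
[cite: HeathBrown2001LargestPrimeFactorCubic, §2 (2.12)] -/
def tscale (X i : ℕ) : ℝ := Npar X * (19 / 20 : ℝ) ^ i

/-- Auxiliary fact `tscale_nonneg` for this file's estimates. [folklore] -/
theorem tscale_nonneg (X i : ℕ) : 0 ≤ tscale X i := by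
  unfold tscale; exact mul_nonneg (Npar_nonneg X) (by positivity)

/-- Auxiliary fact `tscale_le_Npar` for this file's estimates. [folklore] -/
theorem tscale_le_Npar (X i : ℕ) : tscale X i ≤ Npar X := by
  unfold tscale
  exact mul_le_of_le_one_right (Npar_nonneg X) (pow_le_one₀ (by norm_num) (by norm_num))

/-- Auxiliary fact `tscale_succ_le` for this file's estimates. [folklore] -/
theorem tscale_succ_le (X : ℕ) {i j : ℕ} (hij : i < j) : tscale X j ≤ 19 / 20 * tscale X i := by
  unfold tscale
  have h1 : ((19 : ℝ) / 20) ^ j ≤ (19 / 20) ^ (i + 1) :=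
    pow_le_pow_of_le_one (by norm_num) (by norm_num) hij
  calc Npar X * (19 / 20 : ℝ) ^ j ≤ Npar X * (19 / 20) ^ (i + 1) :=
        mul_le_mul_of_nonneg_left h1 (Npar_nonneg X)
    _ = 19 / 20 * (Npar X * (19 / 20) ^ i) := by ring

/-- The admissible scales: those `i` with `X^{1+3δ/2} ≤ 0.93 t_i³`, so that every generator of
scale `i` has `N(α) > 0.93 t_i³ ≥ X^{1+3δ/2}` (Heath-Brown's lower cut `M³X^{δ/2}` of (8.1)).
[cite: HeathBrown2001LargestPrimeFactorCubic, §8 (8.1)] -/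
def scales (X : ℕ) : Finset ℕ :=
  (Finset.range (X + 1)).filter fun i => (X : ℝ) ^ (1 + 3 * hbδ / 2) ≤ 93 / 100 * tscale X i ^ 3

/-- Auxiliary fact `mem_scales` for this file's estimates. [folklore] -/
theorem mem_scales {X i : ℕ} (h : i ∈ scales X) :
    (X : ℝ) ^ (1 + 3 * hbδ / 2) ≤ 93 / 100 * tscale X i ^ 3 := (mem_filter.1 h).2

/-! ### The generator cubes -/

/-- The `a`-range `(t, t + t/100]` of the cube at scale `t`. [cite: HeathBrown2001LargestPrimeFactorCubic, (2.12)] -/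
def aRange (t : ℝ) : Finset ℕ := Finset.Ioc ⌊t⌋₊ ⌊t + t / 100⌋₊

/-- The `b`- and `c`-range `(t/10, t/10 + t/100]`. [cite: HeathBrown2001LargestPrimeFactorCubic, (2.12)] -/
def bcRange (t : ℝ) : Finset ℕ := Finset.Ioc ⌊t / 10⌋₊ ⌊t / 10 + t / 100⌋₊

/-- Auxiliary fact `mem_aRange` for this file's estimates. [folklore] -/
theorem mem_aRange {t : ℝ} (ht : 0 ≤ t) {a : ℕ} (ha : a ∈ aRange t) :
    t < a ∧ (a : ℝ) ≤ t + t / 100 := by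
  rw [aRange, mem_Ioc] at ha
  exact ⟨(Nat.floor_lt ht).1 ha.1, (Nat.le_floor_iff (by positivity)).1 ha.2⟩

/-- Auxiliary fact `mem_bcRange` for this file's estimates. [folklore] -/
theorem mem_bcRange {t : ℝ} (ht : 0 ≤ t) {b : ℕ} (hb : b ∈ bcRange t) :
    t / 10 < b ∧ (b : ℝ) ≤ t / 10 + t / 100 := by
  rw [bcRange, mem_Ioc] at hb
  exact ⟨(Nat.floor_lt (by positivity)).1 hb.1, (Nat.le_floor_iff (by positivity)).1 hb.2⟩

/-- `q = a³ − 2b³` (as an integer). [cite: HeathBrown2001LargestPrimeFactorCubic, Lemma 4] -/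
def qf (a b : ℕ) : ℤ := (a : ℤ) ^ 3 - 2 * (b : ℤ) ^ 3

/-- The norm form `N(a + b∛2 + c∛4) = a³ + 2b³ + 4c³ − 6abc` (as an integer).
[cite: HeathBrown2001LargestPrimeFactorCubic, §2 p. 562] -/
def normf (v : ℕ × ℕ × ℕ) : ℤ :=
  (v.1 : ℤ) ^ 3 + 2 * (v.2.1 : ℤ) ^ 3 + 4 * (v.2.2 : ℤ) ^ 3 - 6 * v.1 * v.2.1 * v.2.2

/-- `N(α)` as a natural number. [cite: HeathBrown2001LargestPrimeFactorCubic, §2 p. 562] -/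
def normNat (v : ℕ × ℕ × ℕ) : ℕ := (normf v).natAbs

/-- The generator `α = a + b∛2 + c∛4 ∈ ℤ[∛2]`. [cite: HeathBrown2001LargestPrimeFactorCubic, Lemma 4] -/
def gen (v : ℕ × ℕ × ℕ) : 𝓞 K := coordElt ((v.1 : ℤ), (v.2.1 : ℤ), (v.2.2 : ℤ))

/-- The principal ideal `J = (α)`. [cite: HeathBrown2001LargestPrimeFactorCubic, Lemma 4] -/
def genIdeal (v : ℕ × ℕ × ℕ) : Ideal (𝓞 K) := Ideal.span {gen v}

/-- Auxiliary fact `norm_gen` for this file's estimates. [folklore] -/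
theorem norm_gen (v : ℕ × ℕ × ℕ) : Algebra.norm ℤ (gen v) = normf v := by
  rw [gen, norm_coordElt, normf]

/-- Auxiliary fact `absNorm_genIdeal` for this file's estimates. [folklore] -/
theorem absNorm_genIdeal (v : ℕ × ℕ × ℕ) : Ideal.absNorm (genIdeal v) = normNat v := by
  rw [genIdeal, Ideal.absNorm_span_singleton, norm_gen, normNat]

/-- The `𝒬`-primes `q₁ ∈ (N^{5/7}, N^{5/7+δ}]` of (2.17). [cite: HeathBrown2001LargestPrimeFactorCubic, (2.17)] -/
def q1Range (X : ℕ) : Finset ℕ :=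
  (Finset.Ioc ⌊Npar X ^ ((5 : ℝ) / 7)⌋₊ ⌊Npar X ^ ((5 : ℝ) / 7 + hbδ)⌋₊).filter Nat.Prime

/-- The `𝒬`-primes `q₂ ∈ (N^{6/7}, N^{6/7+δ}]` of (2.17). [cite: HeathBrown2001LargestPrimeFactorCubic, (2.17)] -/
def q2Range (X : ℕ) : Finset ℕ :=
  (Finset.Ioc ⌊Npar X ^ ((6 : ℝ) / 7)⌋₊ ⌊Npar X ^ ((6 : ℝ) / 7 + hbδ)⌋₊).filter Nat.Prime

/-- The arithmetic conditions on `(a, b)`: `q = a³ − 2b³` squarefree and coprime to `6`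
((2.15)–(2.16)), and `q₁q₂ ∣ q` for some `q₁, q₂` in the ranges (2.17).
[cite: HeathBrown2001LargestPrimeFactorCubic, (2.15)–(2.17)] -/
def IsBasePair (X : ℕ) (ab : ℕ × ℕ) : Prop :=
  Squarefree (qf ab.1 ab.2).natAbs ∧ Nat.Coprime (qf ab.1 ab.2).natAbs 6 ∧
    ∃ q1 ∈ q1Range X, ∃ q2 ∈ q2Range X, ((q1 * q2 : ℕ) : ℤ) ∣ qf ab.1 ab.2

open scoped Classical in
/-- The admissible pairs `(a, b)` at scale `i`: in the cube and satisfying (2.15)–(2.17).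
[cite: HeathBrown2001LargestPrimeFactorCubic, (2.12), (2.15)–(2.17)] -/
def basePairs (X i : ℕ) : Finset (ℕ × ℕ) :=
  (aRange (tscale X i) ×ˢ bcRange (tscale X i)).filter (IsBasePair X)

/-- The admissible `c` for a pair `(a, b)` at scale `t`: in the cube and with
`(b² − ac, q) = (a² + bc, q) = 1` ((2.11)). [cite: HeathBrown2001LargestPrimeFactorCubic, (2.11)] -/
def cSet (t : ℝ) (a b : ℕ) : Finset ℕ :=
  (bcRange t).filter fun c =>
    Int.gcd ((b : ℤ) ^ 2 - a * c) (qf a b) = 1 ∧ Int.gcd ((a : ℤ) ^ 2 + b * c) (qf a b) = 1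

/-- The generators at scale `i` for a choice `P` of admissible pairs: triples `(a, b, c)`.
[cite: HeathBrown2001LargestPrimeFactorCubic, §2 p. 562] -/
def gensAt (X i : ℕ) (P : Finset (ℕ × ℕ)) : Finset (ℕ × ℕ × ℕ) :=
  P.biUnion fun ab => (cSet (tscale X i) ab.1 ab.2).image fun c => (ab.1, ab.2, c)

/-- The full generator set: all scales. [cite: HeathBrown2001LargestPrimeFactorCubic, §2 p. 562] -/
def gens (X : ℕ) (P : ℕ → Finset (ℕ × ℕ)) : Finset (ℕ × ℕ × ℕ) :=
  (scales X).biUnion fun i => gensAt X i (P i)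

/-- Auxiliary fact `mem_gensAt` for this file's estimates. [folklore] -/
theorem mem_gensAt {X i : ℕ} {P : Finset (ℕ × ℕ)} {v : ℕ × ℕ × ℕ} :
    v ∈ gensAt X i P ↔ (v.1, v.2.1) ∈ P ∧ v.2.2 ∈ cSet (tscale X i) v.1 v.2.1 := by
  obtain ⟨a, b, c⟩ := v
  simp only [gensAt, mem_biUnion, mem_image, Prod.mk.injEq, Prod.exists]
  constructor
  · rintro ⟨a', b', hab, c', hc', rfl, rfl, rfl⟩
    exact ⟨hab, hc'⟩
  · rintro ⟨hab, hc⟩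
    exact ⟨a, b, hab, c, hc, rfl, rfl, rfl⟩

/-- Auxiliary fact `mem_gens` for this file's estimates. [folklore] -/
theorem mem_gens {X : ℕ} {P : ℕ → Finset (ℕ × ℕ)} {v : ℕ × ℕ × ℕ} :
    v ∈ gens X P ↔ ∃ i ∈ scales X, (v.1, v.2.1) ∈ P i ∧ v.2.2 ∈ cSet (tscale X i) v.1 v.2.1 := by
  simp only [gens, mem_biUnion, mem_gensAt]

/-! ### Geometry of one cube: sizes of `N(α)`, `q` and `σ₁(α)` -/

section Cube

variable {t : ℝ} {a b c : ℕ}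

/-- In the cube: `0.93 t³ < N(α) < 0.98 t³`. [cite: HeathBrown2001LargestPrimeFactorCubic, (2.12)] -/
theorem normf_bounds (ht : 0 ≤ t) (ha : a ∈ aRange t) (hb : b ∈ bcRange t) (hc : c ∈ bcRange t) :
    93 / 100 * t ^ 3 < (normf (a, b, c) : ℝ) ∧ (normf (a, b, c) : ℝ) < 98 / 100 * t ^ 3 := by
  obtain ⟨ha1, ha2⟩ := mem_aRange ht ha
  obtain ⟨hb1, hb2⟩ := mem_bcRange ht hb
  obtain ⟨hc1, hc2⟩ := mem_bcRange ht hc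
  have e : (normf (a, b, c) : ℝ) = (a : ℝ) ^ 3 + 2 * (b : ℝ) ^ 3 + 4 * (c : ℝ) ^ 3 - 6 * a * b * c := by
    simp [normf]
  rw [e]
  have ht0 : 0 < t := lt_of_le_of_lt (by positivity) (lt_of_lt_of_le hb1 (le_of_lt (by
    have : (0:ℝ) ≤ b := Nat.cast_nonneg b; linarith [hb1])))
  have hb0 : (0 : ℝ) ≤ b := Nat.cast_nonneg b
  have hc0 : (0 : ℝ) ≤ c := Nat.cast_nonneg c
  constructor
  · -- lower bound: `a³ ≥ t³`, `6abc ≤ 6 · 1.01 · 0.11 · 0.11 t³`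
    nlinarith [mul_pos ht0 ht0, mul_pos (mul_pos ht0 ht0) ht0, pow_le_pow_left₀ ht ha1.le 3,
      mul_le_mul ha2 (mul_le_mul hb2 hc2 hc0 (by positivity)) (by positivity) (by positivity),
      pow_le_pow_left₀ (by positivity) hb1.le 3, pow_le_pow_left₀ (by positivity) hc1.le 3]
  · -- upper bound
    nlinarith [mul_pos ht0 ht0, mul_pos (mul_pos ht0 ht0) ht0, pow_le_pow_left₀ (by positivity) ha2 3,
      pow_le_pow_left₀ hb0 hb2 3, pow_le_pow_left₀ hc0 hc2 3,
      mul_le_mul ha1.le (mul_le_mul hb1.le hc1.le (by positivity) hb0) (by positivity) (by positivity)]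

/-- In the cube: `0.99 t³ < q = a³ − 2b³ < 1.04 t³` (so `q > M³`: "x₁³ − 2x₂³ ≥ M³").
[cite: HeathBrown2001LargestPrimeFactorCubic, (2.12)–(2.13)] -/
theorem qf_bounds (ht : 0 ≤ t) (ha : a ∈ aRange t) (hb : b ∈ bcRange t) :
    99 / 100 * t ^ 3 < (qf a b : ℝ) ∧ (qf a b : ℝ) < 104 / 100 * t ^ 3 := by
  obtain ⟨ha1, ha2⟩ := mem_aRange ht ha
  obtain ⟨hb1, hb2⟩ := mem_bcRange ht hb
  have e : (qf a b : ℝ) = (a : ℝ) ^ 3 - 2 * (b : ℝ) ^ 3 := by simp [qf]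
  rw [e]
  have hb0 : (0 : ℝ) ≤ b := Nat.cast_nonneg b
  have ha0 : (0 : ℝ) ≤ a := Nat.cast_nonneg a
  constructor
  · have h1 : t ^ 3 < (a : ℝ) ^ 3 := pow_lt_pow_left₀ ha1 ht (by norm_num)
    have h2 : (b : ℝ) ^ 3 ≤ (t / 10 + t / 100) ^ 3 := pow_le_pow_left₀ hb0 hb2 3
    nlinarith [h1, h2, pow_nonneg ht 3]
  · have h1 : (a : ℝ) ^ 3 ≤ (t + t / 100) ^ 3 := pow_le_pow_left₀ ha0 ha2 3
    have h2 : (t / 10) ^ 3 < (b : ℝ) ^ 3 := pow_lt_pow_left₀ hb1 (by positivity) (by norm_num)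
    nlinarith [h1, h2, pow_nonneg ht 3]

/-- In the cube: `1.28 t < σ₁(α) = a + ρb + ρ²c < 1.34 t` (`5/4 < ρ = ∛2 < 13/10`).
[cite: HeathBrown2001LargestPrimeFactorCubic, (2.13)] -/
theorem ell_bounds (ht : 0 ≤ t) (ha : a ∈ aRange t) (hb : b ∈ bcRange t) (hc : c ∈ bcRange t) :
    128 / 100 * t < ell (castVec ((a : ℤ), (b : ℤ), (c : ℤ))) ∧
      ell (castVec ((a : ℤ), (b : ℤ), (c : ℤ))) < 134 / 100 * t := by
  obtain ⟨ha1, ha2⟩ := mem_aRange ht ha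
  obtain ⟨hb1, hb2⟩ := mem_bcRange ht hb
  obtain ⟨hc1, hc2⟩ := mem_bcRange ht hc
  have e : ell (castVec ((a : ℤ), (b : ℤ), (c : ℤ))) = (a : ℝ) + rho * b + rho ^ 2 * c := by
    simp [ell, castVec]
  rw [e]
  have h1 := rho_gt
  have h2 := rho_lt
  have hb0 : (0 : ℝ) ≤ b := Nat.cast_nonneg b
  have hc0 : (0 : ℝ) ≤ c := Nat.cast_nonneg c
  constructor
  · nlinarith [mul_le_mul h1.le hb1.le (by positivity) (by positivity),
      mul_le_mul (mul_le_mul h1.le h1.le (by norm_num) (by positivity)) hc1.le (by positivity)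
        (by positivity)]
  · nlinarith [mul_le_mul h2.le hb2 hb0 (by norm_num),
      mul_le_mul (mul_le_mul h2.le h2.le (by positivity) (by norm_num)) hc2 hc0 (by norm_num)]

/-- In the cube `N(α) > 0`. [folklore] -/
theorem normf_pos (ht : 0 ≤ t) (ha : a ∈ aRange t) (hb : b ∈ bcRange t) (hc : c ∈ bcRange t) :
    0 < normf (a, b, c) := by
  have h := (normf_bounds ht ha hb hc).1
  have : (0 : ℝ) < normf (a, b, c) := lt_of_le_of_lt (by positivity) h
  exact_mod_cast this

/-- Auxiliary fact `normNat_eq` for this file's estimates. [folklore] -/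
theorem normNat_eq (ht : 0 ≤ t) (ha : a ∈ aRange t) (hb : b ∈ bcRange t) (hc : c ∈ bcRange t) :
    (normNat (a, b, c) : ℤ) = normf (a, b, c) := by
  rw [normNat, Int.natAbs_of_nonneg (normf_pos ht ha hb hc).le]

/-- Auxiliary fact `normNat_real_eq` for this file's estimates. [folklore] -/
theorem normNat_real_eq (ht : 0 ≤ t) (ha : a ∈ aRange t) (hb : b ∈ bcRange t) (hc : c ∈ bcRange t) :
    (normNat (a, b, c) : ℝ) = normf (a, b, c) := by
  have h := normNat_eq ht ha hb hc
  exact_mod_cast h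

end Cube

/-! ### The unit bound `E ≥ 19/5` and the distinctness of the ideals `(α)` -/

/-- **`E ≥ 19/5`**: every unit `u` of `ℤ[∛2]` with coordinates in `[−2, 2]³` and `σ₁(u) > 1` has
`σ₁(u) ≥ 19/5` — the only such unit is `ε₀ = 1 + ∛2 + ∛4` (`σ₁(ε₀) = 3.847…`); checked by exhausting
the `125` vectors: `|N(û)| = 1` leaves eight, of which only `(1,1,1)` has `σ₁ > 1`.
[cite: HeathBrownActa2001, §11 (11.3)] -/
theorem unitE_ge : (19 : ℝ) / 5 ≤ unitE := by
  classical
  refine Finset.le_min' _ _ _ (fun y hy => ?_)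
  obtain ⟨v, hv, rfl⟩ := mem_image.1 hy
  rw [unitBox, mem_filter, mem_product, mem_product, mem_Icc, mem_Icc, mem_Icc] at hv
  obtain ⟨⟨hx, hy', hz⟩, hunit, hell⟩ := hv
  have hN := abs_normForm_eq_one_of_isUnit hunit
  rw [coordVec_coordElt] at hN
  obtain ⟨x, y, z⟩ := v
  simp only at hx hy' hz
  have e : ell (castVec (x, y, z)) = (x : ℝ) + rho * y + rho ^ 2 * z := by simp [ell, castVec]
  have eN : normForm (castVec (x, y, z)) = ((x ^ 3 + 2 * y ^ 3 + 4 * z ^ 3 - 6 * x * y * z : ℤ) : ℝ) := by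
    simp [normForm, castVec]
  rw [e] at hell ⊢
  rw [eN] at hN
  have hN' : (x ^ 3 + 2 * y ^ 3 + 4 * z ^ 3 - 6 * x * y * z : ℤ) = 1 ∨
      (x ^ 3 + 2 * y ^ 3 + 4 * z ^ 3 - 6 * x * y * z : ℤ) = -1 := by
    have h := hN
    rw [← Int.cast_abs] at h
    have h' : |x ^ 3 + 2 * y ^ 3 + 4 * z ^ 3 - 6 * x * y * z| = (1 : ℤ) := by exact_mod_cast h
    exact abs_eq (by norm_num) |>.1 h'
  have h1 := rho_gt
  have h2 := rho_lt
  obtain ⟨hx1, hx2⟩ := hx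
  obtain ⟨hy1, hy2⟩ := hy'
  obtain ⟨hz1, hz2⟩ := hz
  interval_cases x <;> interval_cases y <;> interval_cases z <;>
    first
    | (exfalso; norm_num at hN'; done)
    | (exfalso; norm_num at hell; done)
    | (norm_num at hell ⊢; nlinarith [h1, h2])

/-- Norms separate the scales: a generator of scale `j > i` has norm `< 0.85 t_i³ < 0.93 t_i³`.
[cite: HeathBrown2001LargestPrimeFactorCubic, §2 (2.12)] -/
theorem normf_lt_of_lt_scale (X : ℕ) {i j : ℕ} (hij : i < j) {a b c : ℕ} (ha : a ∈ aRange (tscale X j))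
    (hb : b ∈ bcRange (tscale X j)) (hc : c ∈ bcRange (tscale X j)) :
    (normf (a, b, c) : ℝ) < 93 / 100 * tscale X i ^ 3 := by
  have h := (normf_bounds (tscale_nonneg X j) ha hb hc).2
  have hle := tscale_succ_le X hij
  have h0 := tscale_nonneg X j
  have h3 : tscale X j ^ 3 ≤ (19 / 20 * tscale X i) ^ 3 := pow_le_pow_left₀ h0 hle 3
  nlinarith [pow_nonneg (tscale_nonneg X i) 3]

/-- **The ideals `(α)`, `α ∈ gens`, are pairwise distinct** ("(2.13) will ensure that the ideals
`(α)` are distinct", p. 563): equal ideals have equal norms, hence the same scale, and generators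
differing by a unit `u` with `σ₁(u) ∈ (E⁻¹, E)`, so `u = 1`.
[cite: HeathBrown2001LargestPrimeFactorCubic, §2 p. 563] -/
theorem gens_injective {X : ℕ} {P : ℕ → Finset (ℕ × ℕ)} (hP : ∀ i, P i ⊆ basePairs X i)
    {v w : ℕ × ℕ × ℕ} (hv : v ∈ gens X P) (hw : w ∈ gens X P) (h : genIdeal v = genIdeal w) :
    v = w := by
  classical
  obtain ⟨i, hi, hvP, hvc⟩ := mem_gens.1 hv
  obtain ⟨j, hj, hwP, hwc⟩ := mem_gens.1 hw
  have hvB := mem_filter.1 (hP i hvP)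
  have hwB := mem_filter.1 (hP j hwP)
  obtain ⟨hva, hvb⟩ := mem_product.1 hvB.1
  obtain ⟨hwa, hwb⟩ := mem_product.1 hwB.1
  have hvc' : v.2.2 ∈ bcRange (tscale X i) := (mem_filter.1 hvc).1
  have hwc' : w.2.2 ∈ bcRange (tscale X j) := (mem_filter.1 hwc).1
  -- equal norms
  have hN : (normf v : ℝ) = normf w := by
    have h1 := absNorm_genIdeal v
    have h2 := absNorm_genIdeal w
    rw [h] at h1
    have h12 : normNat v = normNat w := h1.symm.trans h2 |>.symm |> fun e => e.symm
    have ev := normNat_real_eq (tscale_nonneg X i) hva hvb hvc'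
    have ew := normNat_real_eq (tscale_nonneg X j) hwa hwb hwc'
    rw [← ev, ← ew, h12]
  -- hence the same scale
  have hij : i = j := by
    by_contra hne
    rcases lt_or_gt_of_ne hne with hlt | hlt
    · have h1 := normf_lt_of_lt_scale X hlt hwa hwb hwc'
      have h2 := (normf_bounds (tscale_nonneg X i) hva hvb hvc').1
      rw [hN] at h2; linarith
    · have h1 := normf_lt_of_lt_scale X hlt hva hvb hvc'
      have h2 := (normf_bounds (tscale_nonneg X j) hwa hwb hwc').1
      rw [← hN] at h2; linarith
  subst hij
  -- the generators are associated: `gen w = u * gen v`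
  have hassoc : Associated (gen v) (gen w) := Ideal.span_singleton_eq_span_singleton.1 h
  obtain ⟨u, hu⟩ := hassoc
  have ht : 0 ≤ tscale X i := tscale_nonneg X i
  obtain ⟨lv, uv⟩ := ell_bounds ht hva hvb hvc'
  obtain ⟨lw, uw⟩ := ell_bounds ht hwa hwb hwc'
  have hellv : ellO (gen v) = ell (castVec ((v.1 : ℤ), (v.2.1 : ℤ), (v.2.2 : ℤ))) := by
    rw [gen, ellO_coordElt]
  have hellw : ellO (gen w) = ell (castVec ((w.1 : ℤ), (w.2.1 : ℤ), (w.2.2 : ℤ))) := by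
    rw [gen, ellO_coordElt]
  have hmul : ellO (gen w) = ellO (gen v) * ellO (u : 𝓞 K) := by rw [← hu, ellO_mul]
  rw [hellv, hellw] at hmul
  have htpos : 0 < tscale X i := by
    by_contra h0
    push Not at h0
    have : tscale X i = 0 := le_antisymm h0 ht
    rw [this] at lv uv; linarith
  have hvpos : 0 < ell (castVec ((v.1 : ℤ), (v.2.1 : ℤ), (v.2.2 : ℤ))) := by linarith
  -- `σ₁(u) ∈ (0.95, 1.05)`
  have hu_lo : 128 / 134 < ellO (u : 𝓞 K) := by
    by_contra hcon
    push Not at hcon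
    have : ell (castVec ((w.1 : ℤ), (w.2.1 : ℤ), (w.2.2 : ℤ))) ≤
        ell (castVec ((v.1 : ℤ), (v.2.1 : ℤ), (v.2.2 : ℤ))) * (128 / 134) := by
      rw [hmul]; exact mul_le_mul_of_nonneg_left hcon hvpos.le
    nlinarith
  have hu_hi : ellO (u : 𝓞 K) < 134 / 128 := by
    by_contra hcon
    push Not at hcon
    have : ell (castVec ((v.1 : ℤ), (v.2.1 : ℤ), (v.2.2 : ℤ))) * (134 / 128) ≤
        ell (castVec ((w.1 : ℤ), (w.2.1 : ℤ), (w.2.2 : ℤ))) := by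
      rw [hmul]; exact mul_le_mul_of_nonneg_left hcon hvpos.le
    nlinarith
  have hE := unitE_ge
  have hu1 : u = 1 := by
    refine units_eq_one_of_ellO_mem (by linarith) ?_ (by linarith)
    have : unitE⁻¹ ≤ 5 / 19 := by
      rw [inv_le_comm₀ (by linarith) (by norm_num)]; linarith
    linarith
  rw [hu1, Units.val_one, mul_one] at hu
  -- `gen v = gen w` gives `v = w`
  have hinj := coordElt_injective hu
  obtain ⟨a, b, c⟩ := v
  obtain ⟨a', b', c'⟩ := w
  simp only [Prod.mk.injEq, Nat.cast_inj] at hinj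
  obtain ⟨rfl, rfl, rfl⟩ := hinj
  rfl

/-! ### Lemma 4's hypotheses for the generators -/

section Conditions

variable {X : ℕ} {P : ℕ → Finset (ℕ × ℕ)}

/-- Unpacking membership in `gens`: the scale, the cube and the arithmetic conditions. [folklore] -/
theorem gens_spec (hP : ∀ i, P i ⊆ basePairs X i) {v : ℕ × ℕ × ℕ} (hv : v ∈ gens X P) :
    ∃ i ∈ scales X, (v.1, v.2.1) ∈ P i ∧ v.1 ∈ aRange (tscale X i) ∧ v.2.1 ∈ bcRange (tscale X i) ∧
      v.2.2 ∈ bcRange (tscale X i) ∧ IsBasePair X (v.1, v.2.1) ∧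
      Int.gcd ((v.2.1 : ℤ) ^ 2 - v.1 * v.2.2) (qf v.1 v.2.1) = 1 ∧
      Int.gcd ((v.1 : ℤ) ^ 2 + v.2.1 * v.2.2) (qf v.1 v.2.1) = 1 := by
  classical
  obtain ⟨i, hi, hvP, hvc⟩ := mem_gens.1 hv
  have hB := mem_filter.1 (hP i hvP)
  obtain ⟨ha, hb⟩ := mem_product.1 hB.1
  have hc := mem_filter.1 hvc
  exact ⟨i, hi, hvP, ha, hb, hc.1, hB.2, hc.2.1, hc.2.2⟩

/-- `N(α) > 0` for `α ∈ gens`. [folklore] -/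
theorem normf_pos_of_mem_gens (hP : ∀ i, P i ⊆ basePairs X i) {v : ℕ × ℕ × ℕ} (hv : v ∈ gens X P) :
    0 < normf v := by
  obtain ⟨i, -, -, ha, hb, hc, -⟩ := gens_spec hP hv
  exact normf_pos (tscale_nonneg X i) ha hb hc

/-- Auxiliary fact `normNat_cast_of_mem_gens` for this file's estimates. [folklore] -/
theorem normNat_cast_of_mem_gens (hP : ∀ i, P i ⊆ basePairs X i) {v : ℕ × ℕ × ℕ} (hv : v ∈ gens X P) :
    (normNat v : ℤ) = normf v := by
  rw [normNat, Int.natAbs_of_nonneg (normf_pos_of_mem_gens hP hv).le]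

/-- Auxiliary fact `normNat_pos_of_mem_gens` for this file's estimates. [folklore] -/
theorem normNat_pos_of_mem_gens (hP : ∀ i, P i ⊆ basePairs X i) {v : ℕ × ℕ × ℕ} (hv : v ∈ gens X P) :
    0 < normNat v := by
  have h := normNat_cast_of_mem_gens hP hv
  have h2 := normf_pos_of_mem_gens hP hv
  omega

/-- The coprimality hypotheses of Lemma 4 for `α ∈ gens`: `(2, q) = (C, q) = (D, q) = 1`.
[cite: HeathBrown2001LargestPrimeFactorCubic, (2.10)–(2.11)] -/
theorem isCoprime_of_mem_gens (hP : ∀ i, P i ⊆ basePairs X i) {v : ℕ × ℕ × ℕ} (hv : v ∈ gens X P) :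
    IsCoprime (2 : ℤ) ((v.1 : ℤ) ^ 3 - 2 * (v.2.1 : ℤ) ^ 3) ∧
    IsCoprime ((v.2.1 : ℤ) ^ 2 - v.1 * v.2.2) ((v.1 : ℤ) ^ 3 - 2 * (v.2.1 : ℤ) ^ 3) ∧
    IsCoprime ((v.1 : ℤ) ^ 2 + v.2.1 * v.2.2) ((v.1 : ℤ) ^ 3 - 2 * (v.2.1 : ℤ) ^ 3) := by
  obtain ⟨i, -, -, -, -, -, hbase, hC, hD⟩ := gens_spec hP hv
  refine ⟨?_, Int.isCoprime_iff_gcd_eq_one.2 hC, Int.isCoprime_iff_gcd_eq_one.2 hD⟩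
  have h6 : Nat.Coprime (qf v.1 v.2.1).natAbs 6 := hbase.2.1
  have h2 : Nat.Coprime (qf v.1 v.2.1).natAbs 2 := Nat.Coprime.coprime_dvd_right (by norm_num) h6
  rw [Int.isCoprime_iff_gcd_eq_one, Int.gcd_comm]
  rw [Int.gcd, show (2 : ℤ).natAbs = 2 from rfl]
  exact h2

/-- **`ρ((α)) = 1` for `α ∈ gens`**: there is `u` with `uC ≡ 1 (mod N(α))`, and then
`n + ∛2 ∈ (α) ↔ N(α) ∣ n + uB`. [cite: HeathBrown2001LargestPrimeFactorCubic, Lemma 4] -/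
theorem exists_root_of_mem_gens (hP : ∀ i, P i ⊆ basePairs X i) {v : ℕ × ℕ × ℕ} (hv : v ∈ gens X P) :
    ∃ u : ℤ, u * ((v.2.1 : ℤ) ^ 2 - v.1 * v.2.2) ≡ 1 [ZMOD normf v] ∧
      θint - ((u * (2 * (v.2.2 : ℤ) ^ 2 - v.1 * v.2.1) : ℤ) : 𝓞 K) ∈ genIdeal v ∧
      ∀ n : ℕ, (n : 𝓞 K) + θint ∈ genIdeal v ↔
        (normNat v : ℤ) ∣ (n : ℤ) + u * (2 * (v.2.2 : ℤ) ^ 2 - v.1 * v.2.1) := by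
  obtain ⟨-, hC, -⟩ := isCoprime_of_mem_gens hP hv
  obtain ⟨a, b, c⟩ := v
  obtain ⟨u, hu⟩ := exists_inverse_C hC
  refine ⟨u, hu, θint_sub_mem_span hu, fun n => ?_⟩
  rw [normNat_cast_of_mem_gens hP hv]
  exact natCast_add_θint_mem_span_iff (normf_pos_of_mem_gens hP hv) hu n

end Conditions

/-! ### The `𝒦`-primes, the sieve weights and the counts `S`, `S₀`, `S₁`, `W` -/

/-- The `𝒦`-primes: rational primes `p` with `X^{3δ} < p ≤ X^{4δ}` (the norms of the first-degree
prime ideals `K ∈ 𝒦`, (2.4)). [cite: HeathBrown2001LargestPrimeFactorCubic, (2.4)] -/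
def kPrimes (X : ℕ) : Finset ℕ :=
  (Finset.Ioc ⌊(X : ℝ) ^ (3 * hbδ)⌋₊ ⌊(X : ℝ) ^ (4 * hbδ)⌋₊).filter Nat.Prime

/-- Auxiliary fact `mem_kPrimes` for this file's estimates. [folklore] -/
theorem mem_kPrimes {X p : ℕ} (h : p ∈ kPrimes X) :
    p.Prime ∧ (X : ℝ) ^ (3 * hbδ) < p ∧ (p : ℝ) ≤ (X : ℝ) ^ (4 * hbδ) := by
  rw [kPrimes, mem_filter, mem_Ioc] at h
  exact ⟨h.2, (Nat.floor_lt (by positivity)).1 h.1.1, (Nat.le_floor_iff (by positivity)).1 h.1.2⟩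

/-- The sieve level `X^{3δ}` ("sieving limit `D = X^{3δ}`", p. 560). [cite: HeathBrown2001LargestPrimeFactorCubic, §2 p. 560] -/
def sieveLevel (X : ℕ) : ℝ := (X : ℝ) ^ (3 * hbδ)

/-- `Q = P(X^δ) = ∏_{p < X^δ} p` ("we sieve `L`, from below, to level `X^δ`", p. 560; all primes,
see the module docstring). [cite: HeathBrown2001LargestPrimeFactorCubic, §2 p. 561] -/
def sievePrimes (X : ℕ) : ℕ := primesProdBelow ((X : ℝ) ^ hbδ)

/-- The Rosser lower-bound weights `λ_d = μ(d) χ⁻(d)` of dimension `1` (`β = 2`) and level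
`X^{3δ}` ("as described by Iwaniec [7]", p. 560; the tree's `BetaSieve.ind 0 2`).
[cite: HeathBrown2001LargestPrimeFactorCubic, §2 p. 560] -/
def lam (X : ℕ) (d : ℕ) : ℝ := (ArithmeticFunction.moebius d : ℝ) * BetaSieve.ind 0 2 (sieveLevel X) d

/-- `|λ_d| ≤ 1` ((2.7)). [cite: HeathBrown2001LargestPrimeFactorCubic, (2.7)] -/
theorem abs_lam_le (X d : ℕ) : |lam X d| ≤ 1 := by
  rw [lam, abs_mul]
  have h1 : |(ArithmeticFunction.moebius d : ℝ)| ≤ 1 := by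
    have := ArithmeticFunction.abs_moebius_le_one (n := d)
    exact_mod_cast this
  exact mul_le_one₀ h1 (abs_nonneg _) (abs_ind_le_one d)

/-- The sieve weight of the pair `(α, K)`: `∑_{d ∣ (N(α)/N(K), Q)} λ_d`.
[cite: HeathBrown2001LargestPrimeFactorCubic, §2 p. 561] -/
def wt (X : ℕ) (v : ℕ × ℕ × ℕ) (p : ℕ) : ℝ :=
  ∑ d ∈ ((normNat v / p).gcd (sievePrimes X)).divisors, lam X d

/-- **The lower sieve inequality (2.7)**: `∑_{d ∣ (m, Q)} λ_d ≤ [(m, Q) = 1]`.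
[cite: HeathBrown2001LargestPrimeFactorCubic, (2.7)] -/
theorem wt_le (X : ℕ) (v : ℕ × ℕ × ℕ) (p : ℕ) :
    wt X v p ≤ if (normNat v / p).Coprime (sievePrimes X) then 1 else 0 := by
  have hsq : Squarefree ((normNat v / p).gcd (sievePrimes X)) :=
    (squarefree_primesProdBelow _).squarefree_of_dvd (Nat.gcd_dvd_right _ _)
  have h := lower_sieve (β := 2) (D := sieveLevel X) hsq
  unfold wt lam
  exact h

open scoped Classical in
/-- `#𝒜_{(α)} = #{X < n ≤ 2X : (α) ∣ n + ∛2}`. [cite: HeathBrown2001LargestPrimeFactorCubic, §2 p. 557] -/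
def Acount (X : ℕ) (v : ℕ × ℕ × ℕ) : ℕ :=
  #((Ioc X (2 * X)).filter fun n : ℕ => (n : 𝓞 K) + θint ∈ genIdeal v)

/-- The index set of `S`: pairs `(α, p)` with `α ∈ gens`, `p ∈ 𝒦` and `p ∣ N(α)` (equivalently
pairs `(K, L)` with `KL = (α)`, `N(K) = p`). [cite: HeathBrown2001LargestPrimeFactorCubic, §2 p. 561] -/
def pairsVP (X : ℕ) (P : ℕ → Finset (ℕ × ℕ)) : Finset ((ℕ × ℕ × ℕ) × ℕ) :=
  (gens X P ×ˢ kPrimes X).filter fun vp => vp.2 ∣ normNat vp.1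

/-- **`S = ∑_K ∑_{L ∈ 𝓛(K)} (∑_{d ∣ (Q,N(L))} λ_d) #𝒜_{KL}`** (p. 561).
[cite: HeathBrown2001LargestPrimeFactorCubic, §2 p. 561] -/
def Ssum (X : ℕ) (P : ℕ → Finset (ℕ × ℕ)) : ℝ :=
  ∑ vp ∈ pairsVP X P, wt X vp.1 vp.2 * Acount X vp.1

/-- **`S₀ = ∑_K ∑_L (∑_d λ_d) ρ(KL)/N(KL)`** (p. 561; `ρ = 1` on `gens`).
[cite: HeathBrown2001LargestPrimeFactorCubic, §2 p. 561] -/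
def S0sum (X : ℕ) (P : ℕ → Finset (ℕ × ℕ)) : ℝ :=
  ∑ vp ∈ pairsVP X P, wt X vp.1 vp.2 / normNat vp.1

/-- **`S₁ = ∑_K ∑_L (∑_d λ_d) R_{KL}`**, `R_I = #𝒜_I − X/N(I)` (p. 561).
[cite: HeathBrown2001LargestPrimeFactorCubic, §2 p. 561] -/
def S1sum (X : ℕ) (P : ℕ → Finset (ℕ × ℕ)) : ℝ :=
  ∑ vp ∈ pairsVP X P, wt X vp.1 vp.2 * ((Acount X vp.1 : ℝ) - X / normNat vp.1)

open scoped Classical in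
/-- **The weight `W(n)`** `= #{(K, L) : K ∈ 𝒦, L ∈ 𝓛(K), (N(L), Q) = 1, KL ∣ n + ∛2}` (p. 561), as
the number of pairs `(α, p)` with `(α) ∋ n + ∛2`, `p ∣ N(α)`, `(N(α)/p, Q) = 1`.
[cite: HeathBrown2001LargestPrimeFactorCubic, §2 p. 561] -/
def Wt (X : ℕ) (P : ℕ → Finset (ℕ × ℕ)) (n : ℕ) : ℕ :=
  #((pairsVP X P).filter fun vp =>
      (n : 𝓞 K) + θint ∈ genIdeal vp.1 ∧ (normNat vp.1 / vp.2).Coprime (sievePrimes X))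

/-! ### `S = X S₀ + S₁` and `S ≤ ∑ W(n)` -/

/-- **`S = X S₀ + S₁`** (p. 561: "`S = ∑∑(∑λ_d){Xρ(KL)/N(KL) + R_{KL}} = X S₀ + S₁`").
[cite: HeathBrown2001LargestPrimeFactorCubic, §2 p. 561] -/
theorem S_eq (X : ℕ) (P : ℕ → Finset (ℕ × ℕ)) : Ssum X P = X * S0sum X P + S1sum X P := by
  rw [Ssum, S0sum, S1sum, mul_sum, ← sum_add_distrib]
  refine sum_congr rfl (fun vp _ => ?_)
  ring

open scoped Classical in
/-- **`S ≤ ∑_{X < n ≤ 2X} W(n)`** (p. 561, by (2.7)). [cite: HeathBrown2001LargestPrimeFactorCubic, §2 p. 561] -/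
theorem S_le_sum_W (X : ℕ) (P : ℕ → Finset (ℕ × ℕ)) :
    Ssum X P ≤ ∑ n ∈ Ioc X (2 * X), (Wt X P n : ℝ) := by
  have hW : ∀ n, (Wt X P n : ℝ) = ∑ vp ∈ pairsVP X P,
      if (n : 𝓞 K) + θint ∈ genIdeal vp.1 ∧ (normNat vp.1 / vp.2).Coprime (sievePrimes X)
      then (1 : ℝ) else 0 := by
    intro n
    rw [Wt, Finset.card_filter]
    push_cast
    rfl
  have hA : ∀ v, (Acount X v : ℝ) = ∑ n ∈ Ioc X (2 * X),
      if (n : 𝓞 K) + θint ∈ genIdeal v then (1 : ℝ) else 0 := by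
    intro v
    rw [Acount, Finset.card_filter]
    push_cast
    rfl
  simp_rw [hW]
  rw [Finset.sum_comm, Ssum]
  refine sum_le_sum (fun vp _ => ?_)
  rw [hA, mul_sum]
  refine sum_le_sum (fun n _ => ?_)
  have hwt := wt_le X vp.1 vp.2
  by_cases hmem : (n : 𝓞 K) + θint ∈ genIdeal vp.1
  · simp only [hmem, true_and, if_true, mul_one]
    exact hwt
  · simp [hmem]

/-! ### The support of `W`: the divisor `N(α)` -/

/-- For `α ∈ gens`: `X^{1+δ} < X^{1+3δ/2} < N(α) ≤ N³ = X^{1+2δ}`.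
[cite: HeathBrown2001LargestPrimeFactorCubic, (2.3)] -/
theorem normNat_bounds_of_mem_gens {X : ℕ} {P : ℕ → Finset (ℕ × ℕ)} (hP : ∀ i, P i ⊆ basePairs X i)
    {v : ℕ × ℕ × ℕ} (hv : v ∈ gens X P) :
    (X : ℝ) ^ (1 + 3 * hbδ / 2) < normNat v ∧ (normNat v : ℝ) < (X : ℝ) ^ (1 + 2 * hbδ) := by
  obtain ⟨i, hi, -, ha, hb, hc, -⟩ := gens_spec hP hv
  have ht := tscale_nonneg X i
  obtain ⟨h1, h2⟩ := normf_bounds ht ha hb hc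
  have e := normNat_real_eq ht ha hb hc
  have e' : (normNat v : ℝ) = normf v := e
  rw [e']
  refine ⟨lt_of_le_of_lt (mem_scales hi) h1, h2.trans_le ?_⟩
  have h3 : tscale X i ^ 3 ≤ Npar X ^ 3 := pow_le_pow_left₀ ht (tscale_le_Npar X i) 3
  rw [Npar_pow_three] at h3
  nlinarith [Real.rpow_nonneg (Nat.cast_nonneg X) (1 + 2 * hbδ)]

open scoped Classical in
/-- **`W(n) > 0 ⇒ n ∈ 𝒜^{(1)}`** in divisor form (p. 560): if `W(n) > 0` then `n³ + 2` has a
divisor `d = N(α)` with `X^{1+1/321} < d` all of whose prime factors are `≤ 3X` (indeed `≤ X`: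
`N(K) ≤ X^{4δ}` and `N(L) ≤ X^{1+2δ−3δ}`). [cite: HeathBrown2001LargestPrimeFactorCubic, §2 p. 560] -/
theorem W_pos_imp {X : ℕ} {P : ℕ → Finset (ℕ × ℕ)} (hP : ∀ i, P i ⊆ basePairs X i) (hX : 1 ≤ X)
    {n : ℕ} (hW : 0 < Wt X P n) :
    ∃ d : ℕ, d ∣ n ^ 3 + 2 ∧ (X : ℝ) ^ (1 + (1 : ℝ) / 321) < d ∧
      ∀ p : ℕ, p.Prime → p ∣ d → p ≤ 3 * X := by
  rw [Wt, card_pos] at hW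
  obtain ⟨⟨v, p⟩, hvp⟩ := hW
  rw [mem_filter] at hvp
  obtain ⟨hvp, hmem, hcop⟩ := hvp
  rw [pairsVP, mem_filter, mem_product] at hvp
  obtain ⟨⟨hv, hp⟩, hpd⟩ := hvp
  simp only at hmem hcop hpd hv hp
  obtain ⟨hpP, hp1, hp2⟩ := mem_kPrimes hp
  obtain ⟨hN1, hN2⟩ := normNat_bounds_of_mem_gens hP hv
  have hX1 : (1 : ℝ) ≤ X := by exact_mod_cast hX
  refine ⟨normNat v, ?_, ?_, ?_⟩
  · rw [← absNorm_genIdeal]; exact absNorm_dvd_of_natCast_add_θint_mem hmem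
  · refine lt_of_le_of_lt ?_ hN1
    refine Real.rpow_le_rpow_of_exponent_le hX1 ?_
    unfold hbδ; norm_num
  · intro ℓ hℓ hℓd
    obtain ⟨m, hm⟩ := hpd
    have hm' : normNat v / p = m := by
      rw [hm, Nat.mul_div_cancel_left _ hpP.pos]
    rw [hm] at hℓd
    rcases (Nat.Prime.dvd_mul hℓ).1 hℓd with h | h
    · -- `ℓ = p ≤ X^{4δ} ≤ X`
      have hle : ℓ ≤ p := Nat.le_of_dvd hpP.pos h
      have : (p : ℝ) ≤ 3 * X := by
        refine hp2.trans ?_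
        calc (X : ℝ) ^ (4 * hbδ) ≤ (X : ℝ) ^ (1 : ℝ) :=
              Real.rpow_le_rpow_of_exponent_le hX1 (by unfold hbδ; norm_num)
          _ = X := Real.rpow_one _
          _ ≤ 3 * X := by linarith
      exact_mod_cast (show (ℓ : ℝ) ≤ 3 * X from le_trans (by exact_mod_cast hle) this)
    · -- `ℓ ≤ m = N(α)/p < X^{1+2δ}/X^{3δ} ≤ X`
      have hm0 : 0 < m := by
        rcases Nat.eq_zero_or_pos m with h0 | h0
        · rw [h0, mul_zero] at hm
          have := normNat_pos_of_mem_gens hP hv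
          omega
        · exact h0
      have hle : ℓ ≤ m := Nat.le_of_dvd hm0 h
      have hmreal : (m : ℝ) * p = normNat v := by
        rw [hm]; push_cast; ring
      have hp0 : (0 : ℝ) < p := by exact_mod_cast hpP.pos
      have hX0 : (0 : ℝ) < X := by linarith
      have key : (m : ℝ) ≤ X := by
        have h1 : (m : ℝ) * (X : ℝ) ^ (3 * hbδ) ≤ (X : ℝ) ^ (1 + 2 * hbδ) := by
          calc (m : ℝ) * (X : ℝ) ^ (3 * hbδ) ≤ (m : ℝ) * p :=
                mul_le_mul_of_nonneg_left hp1.le (Nat.cast_nonneg m)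
            _ = normNat v := hmreal
            _ ≤ (X : ℝ) ^ (1 + 2 * hbδ) := hN2.le
        have h2 : (X : ℝ) ^ (1 + 2 * hbδ) ≤ X * (X : ℝ) ^ (3 * hbδ) := by
          rw [show (X : ℝ) * (X : ℝ) ^ (3 * hbδ) = (X : ℝ) ^ (1 + 3 * hbδ) by
            rw [Real.rpow_add hX0, Real.rpow_one]]
          exact Real.rpow_le_rpow_of_exponent_le hX1 (by linarith [hbδ_pos])
        have h3 : (0 : ℝ) < (X : ℝ) ^ (3 * hbδ) := Real.rpow_pos_of_pos hX0 _
        nlinarith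
      have : (ℓ : ℝ) ≤ 3 * X := by
        have : (ℓ : ℝ) ≤ m := by exact_mod_cast hle
        linarith
      exact_mod_cast this

/-! ### `W(n) ≤ min(Ω(n), 321) · 2^{Ω(n)}` -/

/-- Rough divisors are few: the number of divisors of `m ≠ 0` all of whose prime factors are
`≥ z` is at most `2^{Ω_z(m)}`, `Ω_z(m)` the number of prime factors `≥ z` of `m` counted with
multiplicity (they divide the `z`-rough part `r` of `m`, and `τ(r) = ∏ (e+1) ≤ 2^{∑ e}`).
[cite: Irving2014LargestPrimeFactorCubic, §2 p. 4] -/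
theorem card_rough_divisors_le (m z : ℕ) (hm : m ≠ 0) :
    #(m.divisors.filter fun d => ∀ p ∈ d.primeFactors, z ≤ p) ≤
      2 ^ ((Nat.primeFactorsList m).filter (fun p => z ≤ p)).length := by
  classical
  set f : ℕ →₀ ℕ := m.factorization.filter (fun p => z ≤ p) with hf
  have hfle : f ≤ m.factorization := by
    intro p
    rw [hf, Finsupp.filter_apply]
    split_ifs
    · exact le_rfl
    · exact Nat.zero_le _
  set r : ℕ := f.prod (· ^ ·) with hr
  have hrfac : r.factorization = f := Nat.factorization_prod_pow_eq_self_of_le_factorization hfle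
  have hr0 : r ≠ 0 := by
    rw [hr, Finsupp.prod_ne_zero_iff]
    intro p hp
    exact pow_ne_zero _ (Nat.prime_of_mem_primeFactors (Finsupp.support_mono hfle hp)).ne_zero
  -- every rough divisor of `m` divides `r`
  have hsub : m.divisors.filter (fun d => ∀ p ∈ d.primeFactors, z ≤ p) ⊆ r.divisors := by
    intro d hd
    rw [mem_filter, Nat.mem_divisors] at hd
    obtain ⟨⟨hdm, -⟩, hrough⟩ := hd
    have hd0 : d ≠ 0 := ne_zero_of_dvd_ne_zero hm hdm
    rw [Nat.mem_divisors]
    refine ⟨(Nat.factorization_le_iff_dvd hd0 hr0).1 ?_, hr0⟩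
    intro p
    rw [hrfac, hf, Finsupp.filter_apply]
    split_ifs with hzp
    · exact (Nat.factorization_le_iff_dvd hd0 hm).2 hdm p
    · have : p ∉ d.primeFactors := fun hp => hzp (hrough p hp)
      rw [← Nat.support_factorization, Finsupp.notMem_support_iff] at this
      rw [this]
  refine (card_le_card hsub).trans ?_
  rw [Nat.card_divisors hr0, ← Nat.support_factorization, hrfac]
  -- `∏ (f p + 1) ≤ ∏ 2^{f p} = 2^{∑ f p}`
  have h1 : ∏ p ∈ f.support, (f p + 1) ≤ ∏ p ∈ f.support, 2 ^ f p :=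
    prod_le_prod' fun p _ => Nat.succ_le_of_lt (Nat.lt_two_pow_self)
  refine h1.trans ?_
  rw [prod_pow_eq_pow_sum]
  apply Nat.pow_le_pow_right (by norm_num)
  -- `∑_{p ∈ supp f} f p = #{prime factors ≥ z with multiplicity}`
  have hsupp : f.support = (m.primeFactorsList.filter (fun p => z ≤ p)).toFinset := by
    ext p
    rw [hf, Finsupp.support_filter, Nat.support_factorization, mem_filter, List.mem_toFinset,
      List.mem_filter, Nat.mem_primeFactors_iff_mem_primeFactorsList]
    simp
  rw [hsupp]
  have hsum : ∑ p ∈ (m.primeFactorsList.filter (fun p => z ≤ p)).toFinset, f p =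
      ∑ p ∈ (m.primeFactorsList.filter (fun p => z ≤ p)).toFinset,
        (m.primeFactorsList.filter (fun p => z ≤ p)).count p := by
    refine sum_congr rfl (fun p hp => ?_)
    rw [List.mem_toFinset, List.mem_filter] at hp
    have hzp : z ≤ p := by simpa using hp.2
    rw [hf, Finsupp.filter_apply_pos _ _ hzp, List.count_filter (by simpa using hzp),
      Nat.primeFactorsList_count_eq]
  rw [hsum, List.sum_toFinset_count_eq_length]

/-- Distinct large primes dividing a bounded number are few: if every `p ∈ s` is a prime `> y`
dividing `m`, `0 < m` and `m < y^{k+1}` (`y ≥ 1`), then `#s ≤ k`. [folklore] -/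
theorem card_le_of_prime_dvd {s : Finset ℕ} {m k : ℕ} {y : ℝ} (hy : 1 ≤ y) (hm : m ≠ 0)
    (hs : ∀ p ∈ s, p.Prime ∧ y < p ∧ p ∣ m) (hmy : (m : ℝ) < y ^ (k + 1)) : #s ≤ k := by
  have hprod : ∏ p ∈ s, p ∣ m := by
    have hsub : s ⊆ m.primeFactors := fun p hp =>
      Nat.mem_primeFactors.2 ⟨(hs p hp).1, (hs p hp).2.2, hm⟩
    exact (prod_dvd_prod_of_subset _ _ _ hsub).trans (Nat.prod_primeFactors_dvd m)
  have hle : ((∏ p ∈ s, p : ℕ) : ℝ) ≤ m := by exact_mod_cast Nat.le_of_dvd (Nat.pos_of_ne_zero hm) hprod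
  have hge : y ^ #s ≤ ((∏ p ∈ s, p : ℕ) : ℝ) := by
    push_cast
    rw [← prod_const]
    exact prod_le_prod (fun _ _ => by linarith) (fun p hp => (hs p hp).2.1.le)
  by_contra hlt
  push Not at hlt
  have : y ^ (k + 1) ≤ y ^ #s := pow_le_pow_right₀ hy hlt
  linarith

open scoped Classical in
/-- **`W(n) ≤ min(Ω(n), 321) · 2^{Ω(n)}`** (p. 561; Irving §2): the map `(α, p) ↦ (N(α)/p, p)` is
injective on the pairs counted by `W(n)` (the ideals `(α) ∋ n + ∛2` are determined by their
norms, Lemma 1, and determine `α`, `gens_injective`), its image consists of an `X^δ`-rough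
divisor of `n³ + 2` and a prime `p ∣ n³ + 2` with `p > X^{3δ}`; there are at most `2^{Ω(n)}` of the
former (`card_rough_divisors_le`) and at most `min(Ω(n), 321)` of the latter once
`10X³ < X^{3δ·322}` (the product of such primes divides `n³ + 2 ≤ 10X³`).
[cite: HeathBrown2001LargestPrimeFactorCubic, §2 p. 561] [cite: Irving2014LargestPrimeFactorCubic, §2 p. 4] -/
theorem W_le {X : ℕ} {P : ℕ → Finset (ℕ × ℕ)} (hP : ∀ i, P i ⊆ basePairs X i) (hX : 1 ≤ X)
    (hX322 : 10 * (X : ℝ) ^ 3 < ((X : ℝ) ^ (3 * hbδ)) ^ (321 + 1)) {n : ℕ} (hn : n ∈ Ioc X (2 * X)) :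
    Wt X P n ≤
      min ((Nat.primeFactorsList (n ^ 3 + 2)).filter (fun p => ⌈(X : ℝ) ^ hbδ⌉₊ ≤ p)).length 321 *
        2 ^ ((Nat.primeFactorsList (n ^ 3 + 2)).filter (fun p => ⌈(X : ℝ) ^ hbδ⌉₊ ≤ p)).length := by
  set m := n ^ 3 + 2 with hmdef
  set z := ⌈(X : ℝ) ^ hbδ⌉₊ with hz
  have hm0 : m ≠ 0 := by positivity
  have hX1 : (1 : ℝ) ≤ X := by exact_mod_cast hX
  set T := (pairsVP X P).filter fun vp =>
      (n : 𝓞 K) + θint ∈ genIdeal vp.1 ∧ (normNat vp.1 / vp.2).Coprime (sievePrimes X) with hT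
  -- the two target sets
  set R := m.divisors.filter (fun d => ∀ p ∈ d.primeFactors, z ≤ p) with hR
  set Kp := m.primeFactors.filter (fun p : ℕ => (X : ℝ) ^ (3 * hbδ) < (p : ℝ)) with hKp
  -- the map
  have hmaps : ∀ vp ∈ T, (normNat vp.1 / vp.2, vp.2) ∈ R ×ˢ Kp := by
    rintro ⟨v, p⟩ hvp
    rw [hT, mem_filter, pairsVP, mem_filter, mem_product] at hvp
    obtain ⟨⟨⟨hv, hp⟩, hpd⟩, hmem, hcop⟩ := hvp
    simp only at hv hp hpd hmem hcop ⊢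
    obtain ⟨hpP, hp1, hp2⟩ := mem_kPrimes hp
    have hNd : normNat v ∣ m := by
      rw [← absNorm_genIdeal]; exact absNorm_dvd_of_natCast_add_θint_mem hmem
    obtain ⟨q, hq⟩ := hpd
    have hq' : normNat v / p = q := by rw [hq, Nat.mul_div_cancel_left _ hpP.pos]
    rw [mem_product]
    constructor
    · rw [hR, mem_filter, Nat.mem_divisors]
      refine ⟨⟨?_, hm0⟩, fun ℓ hℓ => ?_⟩
      · exact (Nat.div_dvd_of_dvd ⟨q, hq⟩).trans hNd
      · -- `ℓ ∣ N/p`, `(N/p, Q) = 1` ⇒ `ℓ ≥ X^δ`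
        have hℓP := Nat.prime_of_mem_primeFactors hℓ
        have hℓd := Nat.dvd_of_mem_primeFactors hℓ
        have hnot : ¬ ℓ ∣ sievePrimes X := fun h => by
          have h1 := Nat.dvd_gcd hℓd h
          rw [hcop.gcd_eq_one, Nat.dvd_one] at h1
          exact hℓP.one_lt.ne' h1
        rw [sievePrimes, dvd_primesProdBelow_iff hℓP] at hnot
        push Not at hnot
        exact Nat.ceil_le.2 hnot
    · rw [hKp, mem_filter, Nat.mem_primeFactors]
      exact ⟨⟨hpP, (dvd_mul_right p q).trans (hq ▸ hNd), hm0⟩, hp1⟩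
  have hinj : Set.InjOn (fun vp : (ℕ × ℕ × ℕ) × ℕ => (normNat vp.1 / vp.2, vp.2)) T := by
    rintro ⟨v, p⟩ hvp ⟨w, p'⟩ hwp h
    simp only [Prod.mk.injEq] at h
    obtain ⟨h1, rfl⟩ := h
    rw [hT, mem_coe, mem_filter, pairsVP, mem_filter, mem_product] at hvp hwp
    obtain ⟨⟨⟨hv, hp⟩, hpv⟩, hmemv, -⟩ := hvp
    obtain ⟨⟨⟨hw, -⟩, hpw⟩, hmemw, -⟩ := hwp
    simp only at hv hp hpv hmemv hw hpw hmemw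
    have hN : normNat v = normNat w := by
      rw [← Nat.div_mul_cancel hpv, ← Nat.div_mul_cancel hpw, h1]
    have hJ : genIdeal v = genIdeal w :=
      eq_of_natCast_add_θint_mem_of_absNorm_eq hmemv hmemw
        (by rw [absNorm_genIdeal, absNorm_genIdeal, hN])
    rw [gens_injective hP hv hw hJ]
  have hcard : #T ≤ #R * #Kp := by
    calc #T ≤ #(R ×ˢ Kp) := card_le_card_of_injOn _ hmaps hinj
      _ = #R * #Kp := card_product _ _
  rw [Wt]
  refine hcard.trans ?_
  rw [mul_comm]
  refine Nat.mul_le_mul ?_ (card_rough_divisors_le m z hm0)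
  -- `#Kp ≤ min(Ω, 321)`
  refine le_min ?_ ?_
  · -- distinct primes `> X^{3δ} ≥ X^δ` dividing `m`, versus all prime factors `≥ z` with multiplicity
    have hsub : Kp ⊆ (m.primeFactorsList.filter (fun p => z ≤ p)).toFinset := by
      intro p hp
      rw [hKp, mem_filter] at hp
      rw [List.mem_toFinset, List.mem_filter]
      refine ⟨Nat.mem_primeFactors_iff_mem_primeFactorsList.1 hp.1, ?_⟩
      have : (X : ℝ) ^ hbδ ≤ p := by
        refine le_trans ?_ hp.2.le
        exact Real.rpow_le_rpow_of_exponent_le hX1 (by linarith [hbδ_pos])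
      simpa [hz] using Nat.ceil_le.2 this
    exact (card_le_card hsub).trans (List.toFinset_card_le _)
  · refine card_le_of_prime_dvd (y := (X : ℝ) ^ (3 * hbδ)) (Real.one_le_rpow hX1 (by
      linarith [hbδ_pos])) hm0 (fun p hp => ?_) ?_
    · rw [hKp, mem_filter, Nat.mem_primeFactors] at hp
      exact ⟨hp.1.1, hp.2, hp.1.2.1⟩
    · refine lt_of_le_of_lt ?_ hX322
      rw [mem_Ioc] at hn
      have h1 : m ≤ 10 * X ^ 3 := by
        have h2 := Nat.pow_le_pow_left hn.2 3
        have hx3 : 1 ≤ X ^ 3 := Nat.one_le_pow _ _ hX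
        have e1 : (2 * X) ^ 3 = 8 * X ^ 3 := by ring
        rw [hmdef]; rw [e1] at h2; omega
      exact_mod_cast h1

end Literature.NumberTheory.Sieve.LargestPrimeFactorCubic
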